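import Mathlib
import Literature.NumberTheory.Transcendental.DrinfeldAssociatorTransport
import Literature.NumberTheory.Transcendental.AssociatorsPairing
import HarnessLib

/-!
# Monodromy toolkit for the KZ equation on `ℙ¹ ∖ {0, 1, ∞}`: holomorphic fundamental solutions

First proofs file towards the HEXAGON half of Drinfeld's theorem "`(2πi, Φ_KZ)` satisfies the
GT-relations" (`drinfeldAssociator_isAssociatorPair`, `DrinfeldAssociator.lean`), i.e. towards
[Drinfeld1991, (2.12) = (5.3)]: the 3-cycle relation
`e^{μA/2} Φ(C,A) e^{μC/2} Φ(B,C) e^{μB/2} Φ(A,B) = 1` (`A + B + C = 0`, `μ = ±2πi`) for `Φ = Φ_KZ`,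
which Drinfeld obtains from the `ℤ/3`-symmetry `z ↦ 1/(1-z)` of the KZ equation
`G'(z) = (A/z + B/(z-1)) G(z)` and the triviality of its monodromy around a contour in the closed
upper half plane passing above `0`, `1` and `∞` [Drinfeld1991, §2; Furusho2011, §1: "It is shown
in [Dr] that `Φ_KZ` satisfies GT-relations (with `μ = 2πi`) by using symmetry of the KZ-system"].
This file contains the complex-analytic core, COEFFICIENTWISE and for an arbitrary alphabet `α` of
letters `c` with holomorphic densities `f_c` (the connection form `ω = Σ_c c ⊗ f_c(z) dz` with
values in the completed free algebra `ℂ⟨⟨α⟩⟩ = NCSeries α ℂ`):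

1. `citerInt g w a b` — iterated integrals of COMPLEX densities `g : α → ℝ → ℂ` over a real
   parameter interval (the complex twin of `iterInt` of `DrinfeldAssociatorTransport.lean`, same
   conventions: leftmost letter = outermost integration), FTC, Chen's identity
   `T̂(a,c) = T̂(b,c) T̂(a,b)` for the transport series `ctransport g a b`, the crude bound
   `‖I_w(a,b)‖ ≤ Π ∫ ‖g_{wᵢ}‖`, and `citerInt (↑f) = ↑(iterInt f)` for real densities.
2. `IsKZSol f U Y` — `Y : ℂ → ℂ⟨⟨α⟩⟩` solves `dY = ω Y` on `U` coefficientwise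
   (`∂ Y_∅ = 0`, `∂ Y_{cw} = f_c Y_w`); solutions are stable under `Y ↦ Y K` (`K` a constant
   series) and differences, and a solution vanishing at one point of a CONVEX open set vanishes
   identically (`IsKZSol.eq_zero`: induction on the word, `∂ = 0 ⇒ const`).
3. `kzFund U f p` — the fundamental solution on an open set `U` on which holomorphic functions
   have primitives (`HasPrims U`; discs by Mathlib's `DifferentiableOn.isExactOn_ball`, and
   increasing unions of such, e.g. open HALF-PLANES, `hasPrims_halfPlane`), normalised by
   `kzFund U f p p = 1`: built by iterated primitives. On convex `U`: Chen
   `J_q(r) J_p(q) = J_p(r)` (`kzFund_mul_kzFund`) and independence of the convex domain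
   (`kzFund_eq_of_subset`), whence the bookkeeping of analytic continuation along overlapping
   convex domains.
4. **Path formula** (`kzFund_path`): along a `C¹` path `γ : [a,b] → U` the fundamental solution
   IS Chen's transport of the pulled-back densities `f_c(γ(t)) γ'(t)`:
   `J_{γ(a)}(γ(b)) = ctransport (f ∘ γ · γ') a b`.
5. **Multilinearity** (`ctransport_linComb`): if `g'_c = Σ_a M(c,a) g_a` then
   `T̂^{g'} = push (flip M) T̂^{g}` (`NCSeries.push` of `AssociatorsPairing.lean`), the
   coefficientwise form of the functoriality of transport under a holomorphic map pulling `ω`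
   back to a letter-substituted copy of itself (used with `z ↦ 1/(1-z)`, `A ↦ B`, `B ↦ -A-B`).

Everything is proved; no named fact is introduced.

## References

* V. G. Drinfel'd, *On quasitriangular quasi-Hopf algebras and on a group that is closely
  connected with Gal(Q̄/Q)*, Leningrad Math. J. 2 (1991), 829–860, §2. [Drinfeld1991]
* H. Furusho, *Double shuffle relation for associators*, Ann. of Math. 174 (2011), §1.
  [Furusho2011]
* K.-T. Chen, *Iterated path integrals*, Bull. AMS 83 (1977), §1–2. Standard material:
  `[folklore]`.
-/

noncomputable section

open MeasureTheory intervalIntegral Set Filter Metric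
open scoped BigOperators Topology

namespace Literature.NumberTheory.Transcendental

universe u
variable {α : Type u}

/-! ## 1. Complex iterated integrals over a real parameter interval -/

/-- **Complex iterated integrals** of the word `w = c₁ ⋯ cₙ` for letter densities
`g : α → ℝ → ℂ` from `a` to `b`: `I_∅ = 1`, `I_{cw}(a,b) = ∫_a^b g_c(t) I_w(a,t) dt` (leftmost letter
= outermost integration, as in `iterInt`). [folklore] -/
def citerInt (g : α → ℝ → ℂ) : List α → ℝ → ℝ → ℂ
  | [], _, _ => 1
  | c :: w, a, b => ∫ t in a..b, g c t * citerInt g w a t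

/-- `I_∅(a,b) = 1`. [folklore] -/
@[simp] theorem citerInt_nil (g : α → ℝ → ℂ) (a b : ℝ) : citerInt g [] a b = 1 := rfl

/-- The defining recursion `I_{cw}(a,b) = ∫_a^b g_c(t) I_w(a,t) dt`. [folklore] -/
theorem citerInt_cons (g : α → ℝ → ℂ) (c : α) (w : List α) (a b : ℝ) :
    citerInt g (c :: w) a b = ∫ t in a..b, g c t * citerInt g w a t := rfl

/-- `I_w(a,a) = 0` for a nonempty word. [folklore] -/
theorem citerInt_self_of_ne_nil (g : α → ℝ → ℂ) {w : List α} (hw : w ≠ []) (a : ℝ) :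
    citerInt g w a a = 0 := by
  cases w with
  | nil => exact absurd rfl hw
  | cons c w => simp [citerInt_cons]

/-- **Real densities**: `I^{↑f}_w = ↑(I^f_w)`. [folklore] -/
theorem citerInt_ofReal (f : α → ℝ → ℝ) (a : ℝ) :
    ∀ (w : List α) (b : ℝ), citerInt (fun c t => (f c t : ℂ)) w a b = (iterInt f w a b : ℂ)
  | [], _ => by simp
  | c :: w, b => by
    rw [citerInt_cons, iterInt_cons, ← intervalIntegral.integral_ofReal]
    refine intervalIntegral.integral_congr fun t _ => ?_
    simp only [citerInt_ofReal f a w t, Complex.ofReal_mul]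

/-- The **complex transport series** `T̂(a,b) = Σ_w I_w(a,b) w ∈ ℂ⟨⟨α⟩⟩`. [folklore] -/
def ctransport (g : α → ℝ → ℂ) (a b : ℝ) : NCSeries α ℂ := fun w => citerInt g w a b

/-- Coefficients of the transport series. [folklore] -/
@[simp] theorem ctransport_apply (g : α → ℝ → ℂ) (a b : ℝ) (w : List α) :
    ctransport g a b w = citerInt g w a b := rfl

/-- `T̂(a,a) = 1`. [folklore] -/
theorem ctransport_self (g : α → ℝ → ℂ) (a : ℝ) : ctransport g a a = 1 := by
  funext w
  cases w with
  | nil => rfl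
  | cons c w => rw [ctransport_apply, citerInt_self_of_ne_nil g (List.cons_ne_nil c w)]; rfl

/-- Real densities: `T̂^{↑f} = map ↑ T̂^{f}`. [folklore] -/
theorem ctransport_ofReal (f : α → ℝ → ℝ) (a b : ℝ) :
    ctransport (fun c t => (f c t : ℂ)) a b = NCSeries.map (algebraMap ℝ ℂ) (transportSeries f a b) := by
  funext w
  rw [ctransport_apply, citerInt_ofReal, NCSeries.map_apply, transportSeries_apply]
  rfl

/-- FTC for the primitive `u ↦ ∫_a^u G` of a complex function continuous on an open interval.
[folklore] -/
theorem hasDerivAt_integral_of_continuousOn_complex {G : ℝ → ℂ} {s : Set ℝ} (hs : IsOpen s)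
    (hso : s.OrdConnected) (hG : ContinuousOn G s) {a b : ℝ} (ha : a ∈ s) (hb : b ∈ s) :
    HasDerivAt (fun u => ∫ t in a..u, G t) (G b) b :=
  intervalIntegral.integral_hasDerivAt_right
    ((hG.mono (hso.uIcc_subset ha hb)).intervalIntegrable)
    (hG.stronglyMeasurableAtFilter hs _ hb) (hG.continuousAt (hs.mem_nhds hb))

section Regularity

variable {g : α → ℝ → ℂ} {s : Set ℝ} (hs : IsOpen s) (hso : s.OrdConnected)
  (hg : ∀ c, ContinuousOn (g c) s) {a : ℝ} (ha : a ∈ s)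
include hs hso hg ha

/-- Continuity of `b ↦ I_w(a,b)` on the interval of continuity of the densities. [folklore] -/
theorem continuousOn_citerInt : ∀ w : List α, ContinuousOn (fun b => citerInt g w a b) s
  | [] => by simpa using continuousOn_const
  | c :: w => by
    have hG : ContinuousOn (fun t => g c t * citerInt g w a t) s := (hg c).mul (continuousOn_citerInt w)
    refine continuousOn_of_forall_continuousAt fun b hb => ?_
    simpa [citerInt_cons] using
      (hasDerivAt_integral_of_continuousOn_complex hs hso hG ha hb).continuousAt

/-- Continuity of the integrand `g_c(t) I_w(a,t)`. [folklore] -/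
theorem continuousOn_mul_citerInt (c : α) (w : List α) :
    ContinuousOn (fun t => g c t * citerInt g w a t) s :=
  (hg c).mul (continuousOn_citerInt hs hso hg ha w)

/-- **FTC in the upper limit**: `∂_b I_{cw}(a,b) = g_c(b) I_w(a,b)`. [folklore] -/
theorem hasDerivAt_citerInt_cons (c : α) (w : List α) {b : ℝ} (hb : b ∈ s) :
    HasDerivAt (fun u => citerInt g (c :: w) a u) (g c b * citerInt g w a b) b := by
  simpa [citerInt_cons] using
    hasDerivAt_integral_of_continuousOn_complex hs hso (continuousOn_mul_citerInt hs hso hg ha c w)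
      ha hb

/-- Interval integrability of the integrand `g_c(t) I_w(a,t)`. [folklore] -/
theorem intervalIntegrable_mul_citerInt (c : α) (w : List α) {b b' : ℝ} (hb : b ∈ s) (hb' : b' ∈ s) :
    IntervalIntegrable (fun t => g c t * citerInt g w a t) volume b b' :=
  ((continuousOn_mul_citerInt hs hso hg ha c w).mono (hso.uIcc_subset hb hb')).intervalIntegrable

/-- **Chen's identity** (coefficientwise): `I_w(a,c) = Σ_{w = uv} I_u(b,c) I_v(a,b)`. [folklore] -/
theorem citerInt_chen {b : ℝ} (hb : b ∈ s) :
    ∀ (w : List α) {c : ℝ}, c ∈ s →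
      citerInt g w a c = ∑ p ∈ NCSeries.splits w, citerInt g p.1 b c * citerInt g p.2 a b
  | [], c, hc => by simp [NCSeries.splits]
  | d :: w, c, hc => by
    rw [NCSeries.sum_splits_cons, citerInt_nil, one_mul, citerInt_cons, citerInt_cons,
      ← integral_add_adjacent_intervals (intervalIntegrable_mul_citerInt hs hso hg ha d w ha hb)
        (intervalIntegrable_mul_citerInt hs hso hg ha d w hb hc)]
    congr 1
    have hcongr : ∀ t ∈ uIcc b c, g d t * citerInt g w a t =
        ∑ p ∈ NCSeries.splits w, g d t * citerInt g p.1 b t * citerInt g p.2 a b := by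
      intro t ht
      rw [citerInt_chen hb w (hso.uIcc_subset hb hc ht), Finset.mul_sum]
      simp_rw [mul_assoc]
    rw [integral_congr hcongr, intervalIntegral.integral_finsetSum]
    · refine Finset.sum_congr rfl fun p _ => ?_
      rw [citerInt_cons, ← intervalIntegral.integral_mul_const]
    · intro p _
      exact ((intervalIntegrable_mul_citerInt hs hso hg hb d p.1 hb hc).mul_const _)

/-- **Chen's identity for the transport series**: `T̂(a,c) = T̂(b,c) T̂(a,b)`. [folklore] -/
theorem ctransport_chen {b c : ℝ} (hb : b ∈ s) (hc : c ∈ s) :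
    ctransport g a c = ctransport g b c * ctransport g a b := by
  funext w
  rw [NCSeries.mul_apply, ctransport_apply, citerInt_chen hs hso hg ha hb w hc]
  rfl

omit hs ha in
/-- Monotonicity of `∫_a^t ‖g c‖` in `t`. [folklore] -/
theorem integral_norm_mono_right {a t b : ℝ} (ha : a ∈ s) (hb : b ∈ s) (hat : a ≤ t) (htb : t ≤ b)
    (c : α) : ∫ x in a..t, ‖g c x‖ ≤ ∫ x in a..b, ‖g c x‖ :=
  intervalIntegral.integral_mono_interval le_rfl hat htb
    (Eventually.of_forall fun _ => norm_nonneg _)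
    (((hg c).mono (hso.uIcc_subset ha hb)).norm.intervalIntegrable)

/-- Crude bound `‖I_w(a,b)‖ ≤ Πᵢ ∫_a^b ‖g_{wᵢ}‖` for `a ≤ b`. [folklore] -/
theorem norm_citerInt_le_prod :
    ∀ (w : List α) {b : ℝ}, b ∈ s → a ≤ b →
      ‖citerInt g w a b‖ ≤ (w.map fun c => ∫ t in a..b, ‖g c t‖).prod
  | [], b, _, _ => by simp
  | c :: w, b, hb, hab => by
    rw [citerInt_cons, List.map_cons, List.prod_cons]
    have hsub : uIcc a b ⊆ s := hso.uIcc_subset ha hb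
    have hcont : ContinuousOn (fun t => g c t * citerInt g w a t) (uIcc a b) :=
      (continuousOn_mul_citerInt hs hso hg ha c w).mono hsub
    calc ‖∫ t in a..b, g c t * citerInt g w a t‖
        ≤ ∫ t in a..b, ‖g c t * citerInt g w a t‖ :=
          intervalIntegral.norm_integral_le_integral_norm hab
      _ ≤ ∫ t in a..b, ‖g c t‖ * (w.map fun c => ∫ t in a..b, ‖g c t‖).prod := by
          refine intervalIntegral.integral_mono_on hab hcont.norm.intervalIntegrable ?_ fun t ht => ?_
          · exact (((hg c).mono hsub).norm.intervalIntegrable).mul_const _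
          · rw [norm_mul]
            have hts : t ∈ s := hsub (by rw [uIcc_of_le hab]; exact ht)
            refine mul_le_mul_of_nonneg_left ((norm_citerInt_le_prod w hts ht.1).trans ?_)
              (norm_nonneg _)
            refine list_prod_map_le_prod_map w (fun c' _ => ?_) fun c' _ => ?_
            · exact intervalIntegral.integral_nonneg ht.1 fun x _ => norm_nonneg _
            · exact integral_norm_mono_right hso hg ha hb ht.1 ht.2 c'
      _ = (∫ t in a..b, ‖g c t‖) * (w.map fun c => ∫ t in a..b, ‖g c t‖).prod :=
          intervalIntegral.integral_mul_const _ _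

end Regularity

/-! ## 2. Solutions of `dY = ω Y` with values in `ℂ⟨⟨α⟩⟩` -/

/-- `Y : ℂ → ℂ⟨⟨α⟩⟩` **solves the KZ-type equation** `dY = ω Y`, `ω = Σ_c c ⊗ f_c(z) dz`, on `U`,
coefficientwise: `∂ Y_∅ = 0` and `∂ Y_{c w} = f_c · Y_w` (letters act on the left, as for
`∂_b T̂(a,b) = ω(b) T̂(a,b)`). [folklore] -/
def IsKZSol (f : α → ℂ → ℂ) (U : Set ℂ) (Y : ℂ → NCSeries α ℂ) : Prop :=
  (∀ z ∈ U, HasDerivAt (fun z => Y z []) 0 z) ∧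
    ∀ (c : α) (w : List α), ∀ z ∈ U, HasDerivAt (fun z => Y z (c :: w)) (f c z * Y z w) z

namespace IsKZSol

variable {f : α → ℂ → ℂ} {U : Set ℂ}

/-- Restriction to a smaller set. [folklore] -/
theorem mono {Y : ℂ → NCSeries α ℂ} (h : IsKZSol f U Y) {V : Set ℂ} (hV : V ⊆ U) : IsKZSol f V Y :=
  ⟨fun z hz => h.1 z (hV hz), fun c w z hz => h.2 c w z (hV hz)⟩

/-- Differences of solutions are solutions. [folklore] -/
theorem sub {Y Z : ℂ → NCSeries α ℂ} (hY : IsKZSol f U Y) (hZ : IsKZSol f U Z) :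
    IsKZSol f U (fun z => Y z - Z z) := by
  refine ⟨fun z hz => ?_, fun c w z hz => ?_⟩
  · have h := (hY.1 z hz).fun_sub (hZ.1 z hz)
    rw [sub_zero] at h
    exact h
  · have h := (hY.2 c w z hz).fun_sub (hZ.2 c w z hz)
    rw [← mul_sub] at h
    exact h

/-- The derivative `(ω Y)_w` of the coefficient `Y_w` of a solution: `0` for `w = ∅`,
`f_c Y_u` for `w = c u`. [folklore] -/
def dcoef (f : α → ℂ → ℂ) (Y : ℂ → NCSeries α ℂ) (z : ℂ) : List α → ℂ
  | [] => 0
  | c :: u => f c z * Y z u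

/-- The derivative of a coefficient of a solution, uniformly in the word. [folklore] -/
theorem hasDerivAt_apply {Y : ℂ → NCSeries α ℂ} (hY : IsKZSol f U Y) {z : ℂ} (hz : z ∈ U)
    (w : List α) : HasDerivAt (fun z => Y z w) (dcoef f Y z w) z := by
  cases w with
  | nil => exact hY.1 z hz
  | cons c w => exact hY.2 c w z hz

/-- **Right multiplication by a constant series** preserves solutions: `d(YK) = ω (YK)`.
[folklore] -/
theorem mul_const {Y : ℂ → NCSeries α ℂ} (hY : IsKZSol f U Y) (K : NCSeries α ℂ) :
    IsKZSol f U (fun z => Y z * K) := by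
  have key : ∀ (w : List α), ∀ z ∈ U, HasDerivAt (fun z => (Y z * K) w)
      (∑ p ∈ NCSeries.splits w, dcoef f Y z (p : List α × List α).1 * K p.2) z := by
    intro w z hz
    simp only [NCSeries.mul_apply]
    exact HasDerivAt.fun_sum fun (p : List α × List α) _ => (hY.hasDerivAt_apply hz p.1).mul_const (K p.2)
  refine ⟨fun z hz => ?_, fun c w z hz => ?_⟩
  · have h := key [] z hz
    simpa [NCSeries.splits, dcoef] using h
  · have h := key (c :: w) z hz
    rw [NCSeries.sum_splits_cons] at h
    simp only [dcoef, zero_mul, zero_add] at h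
    convert h using 1
    dsimp only
    rw [NCSeries.mul_apply, Finset.mul_sum]
    refine Finset.sum_congr rfl fun p _ => ?_
    ring

/-- Each coefficient of a solution is holomorphic on `U`. [folklore] -/
theorem differentiableOn_apply {Y : ℂ → NCSeries α ℂ} (hY : IsKZSol f U Y) (w : List α) :
    DifferentiableOn ℂ (fun z => Y z w) U := fun _ hz =>
  (hY.hasDerivAt_apply hz w).differentiableAt.differentiableWithinAt

/-- **Uniqueness**: a solution on a convex open set vanishing at one point vanishes identically
(induction on the length of the word: `∂ Y_∅ = 0`, then `∂ Y_{cw} = f_c Y_w = 0`). [folklore] -/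
theorem eq_zero {Y : ℂ → NCSeries α ℂ} (hY : IsKZSol f U Y) (hU : IsOpen U) (hUc : Convex ℝ U)
    {p : ℂ} (hp : p ∈ U) (h0 : Y p = 0) : ∀ w : List α, ∀ z ∈ U, Y z w = 0 := by
  intro w
  induction w with
  | nil =>
    intro z hz
    have hc := hU.is_const_of_deriv_eq_zero hUc.isPreconnected (hY.differentiableOn_apply [])
      (fun x hx => by rw [(hY.1 x hx).deriv]; rfl) hz hp
    rw [hc, h0]; rfl
  | cons c w ih =>
    intro z hz
    have hc := hU.is_const_of_deriv_eq_zero hUc.isPreconnected (hY.differentiableOn_apply (c :: w))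
      (fun x hx => by rw [(hY.2 c w x hx).deriv, ih x hx, mul_zero]; rfl) hz hp
    rw [hc, h0]; rfl

/-- **Uniqueness**: two solutions on a convex open set agreeing at one point agree everywhere.
[folklore] -/
theorem eq_of_eq {Y Z : ℂ → NCSeries α ℂ} (hY : IsKZSol f U Y) (hZ : IsKZSol f U Z) (hU : IsOpen U)
    (hUc : Convex ℝ U) {p : ℂ} (hp : p ∈ U) (h0 : Y p = Z p) : ∀ z ∈ U, Y z = Z z := by
  intro z hz
  funext w
  have h := (hY.sub hZ).eq_zero hU hUc hp (by simp [h0]) w z hz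
  simpa [sub_eq_zero] using h

end IsKZSol

/-! ## 3. Fundamental solutions on domains with primitives -/

/-- `U` **has primitives**: every function holomorphic on `U` is a complex derivative on `U`
(Mathlib's `Complex.IsExactOn`). [folklore] -/
def HasPrims (U : Set ℂ) : Prop := ∀ g : ℂ → ℂ, DifferentiableOn ℂ g U → Complex.IsExactOn g U

/-- **Discs have primitives** (Mathlib's Morera/Cauchy theorem for a disc,
`DifferentiableOn.isExactOn_ball`). [folklore] -/
theorem hasPrims_ball (c : ℂ) (r : ℝ) : HasPrims (ball c r) := fun _ hg => hg.isExactOn_ball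

/-- A **primitive operator** on `U`: `prim U g` is some primitive of `g` on `U` when one exists
(and `0` otherwise). [folklore] -/
def prim (U : Set ℂ) (g : ℂ → ℂ) : ℂ → ℂ := by
  classical exact if h : Complex.IsExactOn g U then Classical.choose h else 0

/-- `prim U g` is a primitive of a holomorphic `g` on a domain with primitives. [folklore] -/
theorem hasDerivAt_prim {U : Set ℂ} (hU : HasPrims U) {g : ℂ → ℂ} (hg : DifferentiableOn ℂ g U)
    {z : ℂ} (hz : z ∈ U) : HasDerivAt (prim U g) (g z) z := by
  have h := hU g hg
  simp only [prim, dif_pos h]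
  exact Classical.choose_spec h z hz

/-- The coefficient functions of the fundamental solution, by **iterated primitives**:
`J_∅ = 1`, `J_{cw}(z) = F(z) - F(p)` with `F` a primitive of `f_c J_w`. [folklore] -/
def kzFundAux (U : Set ℂ) (f : α → ℂ → ℂ) (p : ℂ) : List α → ℂ → ℂ
  | [] => fun _ => 1
  | c :: w => fun z =>
      prim U (fun u => f c u * kzFundAux U f p w u) z -
        prim U (fun u => f c u * kzFundAux U f p w u) p

/-- **The fundamental solution** `J_p = kzFund U f p : ℂ → ℂ⟨⟨α⟩⟩` of `dY = ω Y` on `U`,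
normalised by `J_p(p) = 1`. [folklore] -/
def kzFund (U : Set ℂ) (f : α → ℂ → ℂ) (p : ℂ) : ℂ → NCSeries α ℂ := fun z w => kzFundAux U f p w z

/-- `J_p(z)_∅ = 1`. [folklore] -/
@[simp] theorem kzFund_apply_nil (U : Set ℂ) (f : α → ℂ → ℂ) (p z : ℂ) : kzFund U f p z [] = 1 := rfl

/-- The recursion of the coefficients of `J_p`. [folklore] -/
theorem kzFund_apply_cons (U : Set ℂ) (f : α → ℂ → ℂ) (p z : ℂ) (c : α) (w : List α) :
    kzFund U f p z (c :: w) =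
      prim U (fun u => f c u * kzFund U f p u w) z - prim U (fun u => f c u * kzFund U f p u w) p :=
  rfl

/-- **Normalisation** `J_p(p) = 1`. [folklore] -/
theorem kzFund_self (U : Set ℂ) (f : α → ℂ → ℂ) (p : ℂ) : kzFund U f p p = 1 := by
  funext w
  cases w with
  | nil => rfl
  | cons c w => rw [kzFund_apply_cons, sub_self]; rfl

section Fund

variable {U : Set ℂ} (hU : HasPrims U) {f : α → ℂ → ℂ} (hf : ∀ c, DifferentiableOn ℂ (f c) U)
include hU hf

/-- The coefficients of `J_p` are holomorphic on `U`. [folklore] -/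
theorem differentiableOn_kzFund (p : ℂ) : ∀ w : List α, DifferentiableOn ℂ (fun z => kzFund U f p z w) U
  | [] => by
    show DifferentiableOn ℂ (fun _ => (1 : ℂ)) U
    exact differentiableOn_const _
  | c :: w => by
    have hg : DifferentiableOn ℂ (fun u => f c u * kzFund U f p u w) U :=
      (hf c).mul (differentiableOn_kzFund p w)
    intro z hz
    simp only [kzFund_apply_cons]
    exact ((hasDerivAt_prim hU hg hz).differentiableAt.sub_const _).differentiableWithinAt

/-- **`J_p` solves `dY = ω Y` on `U`.** [folklore] -/
theorem isKZSol_kzFund (p : ℂ) : IsKZSol f U (kzFund U f p) := by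
  refine ⟨fun z _ => by simpa using hasDerivAt_const z (1 : ℂ), fun c w z hz => ?_⟩
  have hg : DifferentiableOn ℂ (fun u => f c u * kzFund U f p u w) U :=
    (hf c).mul (differentiableOn_kzFund hU hf p w)
  simp only [kzFund_apply_cons]
  exact (hasDerivAt_prim hU hg hz).sub_const _

/-- **Chen's identity for fundamental solutions** on a convex domain: `J_q(r) J_p(q) = J_p(r)`
(both sides solve `dY = ω Y` in `r` and agree at `r = q`). [folklore] -/
theorem kzFund_mul_kzFund (hUo : IsOpen U) (hUc : Convex ℝ U) (p : ℂ) {q : ℂ} (hq : q ∈ U) :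
    ∀ r ∈ U, kzFund U f q r * kzFund U f p q = kzFund U f p r := by
  refine ((isKZSol_kzFund hU hf q).mul_const (kzFund U f p q)).eq_of_eq (isKZSol_kzFund hU hf p)
    hUo hUc hq ?_
  simp only [kzFund_self, one_mul]

omit hU hf in
/-- The unused-hypothesis-free form of domain independence: two solutions normalised at `p` on
overlapping convex open domains agree on the (convex) overlap. [folklore] -/
theorem IsKZSol.eq_on_inter {V : Set ℂ} {Y Z : ℂ → NCSeries α ℂ} (hY : IsKZSol f U Y)
    (hZ : IsKZSol f V Z) (hUo : IsOpen U) (hVo : IsOpen V) (hUc : Convex ℝ U) (hVc : Convex ℝ V)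
    {p : ℂ} (hpU : p ∈ U) (hpV : p ∈ V) (h0 : Y p = Z p) : ∀ z ∈ U ∩ V, Y z = Z z :=
  (hY.mono inter_subset_left).eq_of_eq (hZ.mono inter_subset_right) (hUo.inter hVo)
    (hUc.inter hVc) ⟨hpU, hpV⟩ h0

/-- **Independence of the domain**: the fundamental solutions of two overlapping convex domains
with primitives, normalised at a common point, agree on the overlap — the bookkeeping of analytic
continuation. [folklore] -/
theorem kzFund_eq_on_inter {V : Set ℂ} (hV : HasPrims V) (hfV : ∀ c, DifferentiableOn ℂ (f c) V)
    (hUo : IsOpen U) (hVo : IsOpen V) (hUc : Convex ℝ U) (hVc : Convex ℝ V) {p : ℂ} (hpU : p ∈ U)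
    (hpV : p ∈ V) : ∀ z ∈ U ∩ V, kzFund U f p z = kzFund V f p z :=
  (isKZSol_kzFund hU hf p).eq_on_inter (isKZSol_kzFund hV hfV p) hUo hVo hUc hVc hpU hpV
    (by rw [kzFund_self, kzFund_self])

end Fund

/-! ## 4. The path formula: fundamental solutions are Chen's transports along paths -/

/-- A closed real interval inside an open set has an open interval neighbourhood inside it.
[folklore] -/
theorem exists_Ioo_subset_of_Icc_subset {S : Set ℝ} (hS : IsOpen S) {a b : ℝ} (hab : a ≤ b)
    (h : Icc a b ⊆ S) : ∃ a' b', a' < a ∧ b < b' ∧ Ioo a' b' ⊆ S := by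
  obtain ⟨ε₁, hε₁, h₁⟩ := Metric.isOpen_iff.mp hS a (h (left_mem_Icc.mpr hab))
  obtain ⟨ε₂, hε₂, h₂⟩ := Metric.isOpen_iff.mp hS b (h (right_mem_Icc.mpr hab))
  refine ⟨a - ε₁, b + ε₂, by linarith, by linarith, fun x hx => ?_⟩
  rcases lt_or_ge x a with hxa | hxa
  · exact h₁ (by rw [Metric.mem_ball, Real.dist_eq, abs_lt]; constructor <;> linarith [hx.1])
  rcases le_or_gt x b with hxb | hxb
  · exact h ⟨hxa, hxb⟩
  · exact h₂ (by rw [Metric.mem_ball, Real.dist_eq, abs_lt]; constructor <;> linarith [hx.2])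

/-- **Path formula.** Let `Y` solve `dY = ω Y` on an open `U` with `Y(γ(a)) = 1`, the densities
being continuous on `U`, and let `γ` be a `C¹` path with `γ([a,b]) ⊆ U`. Then `Y(γ(b))` is Chen's
transport series of the pulled-back densities `g_c(t) = f_c(γ(t)) γ'(t)` over `[a,b]`: both
`t ↦ Y(γ(t))` and `t ↦ T̂^{g}(a,t)` solve the same triangular system of ODEs with the same initial
value. [folklore] -/
theorem IsKZSol.path {f : α → ℂ → ℂ} {U : Set ℂ} (hUo : IsOpen U)
    (hfc : ∀ c, ContinuousOn (f c) U) {Y : ℂ → NCSeries α ℂ} (hY : IsKZSol f U Y)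
    {γ γ' : ℝ → ℂ} (hγ : ∀ t, HasDerivAt γ (γ' t) t) (hγ' : Continuous γ') {a b : ℝ} (hab : a ≤ b)
    (hmaps : MapsTo γ (Icc a b) U) (h0 : Y (γ a) = 1) :
    Y (γ b) = ctransport (fun c t => f c (γ t) * γ' t) a b := by
  have hγc : Continuous γ := continuous_iff_continuousAt.mpr fun t => (hγ t).continuousAt
  obtain ⟨a', b', ha', hb', hsub⟩ :=
    exists_Ioo_subset_of_Icc_subset (hUo.preimage hγc) hab (fun t ht => hmaps ht)
  set s : Set ℝ := Ioo a' b' with hs_def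
  have hs : IsOpen s := isOpen_Ioo
  have hso : s.OrdConnected := ordConnected_Ioo
  have has : a ∈ s := ⟨ha', lt_of_le_of_lt hab hb'⟩
  set g : α → ℝ → ℂ := fun c t => f c (γ t) * γ' t with hg_def
  have hg : ∀ c, ContinuousOn (g c) s := by
    intro c t ht
    have hγt : γ t ∈ U := hsub ht
    exact (((hfc c).continuousAt (hUo.mem_nhds hγt)).comp hγc.continuousAt).continuousWithinAt.mul
      hγ'.continuousWithinAt
  -- induction on the word, for all `t ∈ [a, b]`
  suffices key : ∀ w : List α, ∀ t ∈ Icc a b, Y (γ t) w = citerInt g w a t by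
    funext w; exact key w b (right_mem_Icc.mpr hab)
  intro w
  induction w with
  | nil =>
    intro t ht
    -- `Y_∅` is constant along the path
    have hD : ∀ x ∈ Icc a b, Y (γ x) [] = Y (γ a) [] := by
      refine constant_of_has_deriv_right_zero (f := fun x => Y (γ x) []) ?_ ?_
      · intro x hx
        exact (((hY.1 (γ x) (hmaps hx)).comp x (hγ x)).continuousAt).continuousWithinAt
      · intro x hx
        have h := (hY.1 (γ x) (hmaps (Ico_subset_Icc_self hx))).comp x (hγ x)
        rw [zero_mul] at h
        exact h.hasDerivWithinAt
    rw [hD t ht, h0]; rfl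
  | cons c w ih =>
    intro t ht
    have hderiv : ∀ x ∈ s, HasDerivAt (fun x => Y (γ x) (c :: w) - citerInt g (c :: w) a x)
        (f c (γ x) * Y (γ x) w * γ' x - g c x * citerInt g w a x) x := fun x hx =>
      ((hY.2 c w (γ x) (hsub hx)).comp x (hγ x)).sub (hasDerivAt_citerInt_cons hs hso hg has c w hx)
    have hD : ∀ x ∈ Icc a b, Y (γ x) (c :: w) - citerInt g (c :: w) a x =
        Y (γ a) (c :: w) - citerInt g (c :: w) a a := by
      refine constant_of_has_deriv_right_zero ?_ ?_
      · intro x hx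
        have hxs : x ∈ s := ⟨by linarith [hx.1], by linarith [hx.2]⟩
        exact (hderiv x hxs).continuousAt.continuousWithinAt
      · intro x hx
        have hxs : x ∈ s := ⟨by linarith [hx.1], by linarith [hx.2]⟩
        have h := hderiv x hxs
        rw [ih x (Ico_subset_Icc_self hx), hg_def] at h
        simp only at h
        rw [show f c (γ x) * citerInt (fun c t => f c (γ t) * γ' t) w a x * γ' x -
            f c (γ x) * γ' x * citerInt (fun c t => f c (γ t) * γ' t) w a x = 0 by ring] at h
        exact h.hasDerivWithinAt
    have h := hD t ht
    rw [h0, citerInt_self_of_ne_nil g (List.cons_ne_nil c w), NCSeries.one_apply_cons, sub_zero,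
      sub_eq_zero] at h
    exact h

/-- **Path formula for the fundamental solution**: `J_{γ(a)}(γ(b)) = T̂^{f∘γ·γ'}(a,b)` for a `C¹`
path in a domain with primitives. [folklore] -/
theorem kzFund_path {f : α → ℂ → ℂ} {U : Set ℂ} (hU : HasPrims U) (hUo : IsOpen U)
    (hf : ∀ c, DifferentiableOn ℂ (f c) U) {γ γ' : ℝ → ℂ} (hγ : ∀ t, HasDerivAt γ (γ' t) t)
    (hγ' : Continuous γ') {a b : ℝ} (hab : a ≤ b) (hmaps : MapsTo γ (Icc a b) U) :
    kzFund U f (γ a) (γ b) = ctransport (fun c t => f c (γ t) * γ' t) a b :=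
  (isKZSol_kzFund hU hf (γ a)).path hUo (fun c => (hf c).continuousOn) hγ hγ' hab hmaps
    (kzFund_self U f (γ a))

/-! ## 5. Multilinearity of the transport in the densities -/

namespace NCSeries

section PushClosedForm

variable {β : Type*} [Fintype β] {K : Type*} [CommRing K]

/-- Closed formula for the pushforward on words `List.ofFn x`:
`c_x(push m φ) = Σ_{|u| = |x|} c_u(φ) ∏ᵢ m(uᵢ, xᵢ)`. (This is `NCSeries.push_ofFn` of
`AssociatorsDefectSeriesProofs.lean` = `DrinfeldAssociatorToolkit.lean`; those two modules declare the
same fully-qualified names and cannot both be imported by the files downstream of this one, whence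
this private copy.) [folklore] -/
private theorem push_ofFn_aux (m : β → α → K) : ∀ (n : ℕ) (φ : NCSeries β K) (x : Fin n → α),
    push m φ (List.ofFn x) = ∑ u : Fin n → β, φ (List.ofFn u) * ∏ i, m (u i) (x i)
  | 0, φ, x => by simp
  | n + 1, φ, x => by
    rw [List.ofFn_succ, push_cons, sum_fin_succ_fun]
    refine Finset.sum_congr rfl fun b _ => ?_
    rw [push_ofFn_aux m n (lderiv b φ) (fun i => x i.succ), Finset.mul_sum]
    refine Finset.sum_congr rfl fun u _ => ?_
    simp only [Fin.prod_univ_succ, Fin.cons_zero, Fin.cons_succ, List.ofFn_succ, lderiv_apply]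
    ring

/-- **Closed formula for the pushforward on a word**:
`c_x(push m φ) = Σ_{u : Fin |x| → β} c_{u}(φ) ∏ᵢ m(uᵢ, xᵢ)`. [folklore] -/
theorem push_eq_sum_get (m : β → α → K) (φ : NCSeries β K) (x : List α) :
    push m φ x = ∑ u : Fin x.length → β, φ (List.ofFn u) * ∏ i, m (u i) (x.get i) := by
  conv_lhs => rw [← List.ofFn_get x]
  rw [push_ofFn_aux]

omit [Fintype β] in
/-- Non-commutative multinomial expansion of an ordered product of sums (private copy of
`NCSeries.prod_ofFn_sum_smul`, see `push_ofFn_aux`). [folklore] -/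
private theorem prod_ofFn_sum_smul_aux {A : Type*} [Ring A] [Algebra K A] [Fintype α] (m : β → α → K)
    (v : α → A) : ∀ (n : ℕ) (u : Fin n → β),
    (List.ofFn fun i => ∑ f : α, m (u i) f • v f).prod =
      ∑ x : Fin n → α, (∏ i, m (u i) (x i)) • (List.ofFn fun i => v (x i)).prod
  | 0, u => by simp
  | n + 1, u => by
    rw [List.ofFn_succ, List.prod_cons, prod_ofFn_sum_smul_aux m v n (fun i => u i.succ),
      Finset.sum_mul_sum, sum_fin_succ_fun]
    refine Finset.sum_congr rfl fun f _ => Finset.sum_congr rfl fun x _ => ?_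
    simp only [Fin.prod_univ_succ, Fin.cons_zero, Fin.cons_succ, List.ofFn_succ, List.prod_cons]
    rw [smul_mul_assoc, mul_smul_comm, smul_smul]

/-- **Pushforward and substitution** (general coefficients): `(push m φ)(v) = φ(b ↦ Σ_f m(b,f) v(f))`
weight by weight. (Statement of `NCSeries.evalTrunc_push` of `AssociatorsDefectSeriesProofs.lean`,
restated under a new name for the import reason explained at `push_eq_sum_get`.)
[cite: Reutenauer1993, §1.4] -/
theorem evalTrunc_push_subst {A : Type*} [Ring A] [Algebra K A] [Fintype α] (N : ℕ) (m : β → α → K)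
    (v : α → A) (φ : NCSeries β K) :
    evalTrunc N v (push m φ) = evalTrunc N (fun b => ∑ f : α, m b f • v f) φ := by
  unfold evalTrunc
  refine Finset.sum_congr rfl fun n _ => ?_
  simp_rw [List.map_ofFn]
  calc ∑ x : Fin n → α, push m φ (List.ofFn x) • (List.ofFn (v ∘ x)).prod
      = ∑ x : Fin n → α, ∑ u : Fin n → β,
          (φ (List.ofFn u) * ∏ i, m (u i) (x i)) • (List.ofFn (v ∘ x)).prod := by
        refine Finset.sum_congr rfl fun x _ => ?_
        rw [push_ofFn_aux, Finset.sum_smul]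
    _ = ∑ u : Fin n → β, ∑ x : Fin n → α,
          (φ (List.ofFn u) * ∏ i, m (u i) (x i)) • (List.ofFn (v ∘ x)).prod := Finset.sum_comm
    _ = ∑ u : Fin n → β, φ (List.ofFn u) • (List.ofFn ((fun b => ∑ f, m b f • v f) ∘ u)).prod := by
        refine Finset.sum_congr rfl fun u _ => ?_
        rw [show List.ofFn ((fun b => ∑ f, m b f • v f) ∘ u) =
            List.ofFn (fun i => ∑ f, m (u i) f • v f) from rfl, prod_ofFn_sum_smul_aux, Finset.smul_sum]
        refine Finset.sum_congr rfl fun x _ => ?_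
        rw [mul_smul]
        rfl

end PushClosedForm

end NCSeries

section LinComb

variable {β : Type*} [Fintype β] {g : β → ℝ → ℂ} {s : Set ℝ} (hs : IsOpen s)
  (hso : s.OrdConnected) (hg : ∀ b, ContinuousOn (g b) s) {a : ℝ} (ha : a ∈ s)
include hs hso hg ha

/-- Multilinearity on words enumerated as `List.ofFn`:
`I^{g'}_{x}(a,b) = Σ_u (Π m(uᵢ,xᵢ)) I^{g}_{u}(a,b)` for `g'_c = Σ_b m(b,c) g_b`. [folklore] -/
theorem citerInt_linComb_ofFn (m : β → α → ℂ) : ∀ (n : ℕ) (x : Fin n → α) {b' : ℝ}, b' ∈ s →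
    citerInt (fun c t => ∑ b, m b c * g b t) (List.ofFn x) a b' =
      ∑ u : Fin n → β, citerInt g (List.ofFn u) a b' * ∏ i, m (u i) (x i)
  | 0, x, b', _ => by simp
  | n + 1, x, b', hb' => by
    have hsub : uIcc a b' ⊆ s := hso.uIcc_subset ha hb'
    rw [List.ofFn_succ, citerInt_cons]
    have hcongr : ∀ t ∈ uIcc a b',
        (∑ b, m b (x 0) * g b t) *
            citerInt (fun c t => ∑ b, m b c * g b t) (List.ofFn fun i => x i.succ) a t =
          ∑ p : β × (Fin n → β), (m p.1 (x 0) * ∏ i, m (p.2 i) (x i.succ)) *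
            (g p.1 t * citerInt g (List.ofFn p.2) a t) := by
      intro t ht
      rw [citerInt_linComb_ofFn m n (fun i => x i.succ) (hsub ht), Finset.sum_mul_sum,
        ← Finset.univ_product_univ, Finset.sum_product]
      refine Finset.sum_congr rfl fun b _ => Finset.sum_congr rfl fun u _ => ?_
      ring
    rw [intervalIntegral.integral_congr hcongr, intervalIntegral.integral_finsetSum]
    · rw [NCSeries.sum_fin_succ_fun, ← Finset.univ_product_univ, Finset.sum_product]
      refine Finset.sum_congr rfl fun b _ => Finset.sum_congr rfl fun u _ => ?_
      rw [intervalIntegral.integral_const_mul, ← citerInt_cons, List.ofFn_cons, Fin.prod_univ_succ]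
      simp only [Fin.cons_zero, Fin.cons_succ]
      ring
    · intro p _
      exact (intervalIntegrable_mul_citerInt hs hso hg ha p.1 (List.ofFn p.2) ha hb').const_mul _

/-- **Multilinearity of Chen's transport**: if the densities of the letters `c : α` are the linear
combinations `g'_c = Σ_b m(b,c) g_b` of densities indexed by `b : β`, then
`T̂^{g'}(a,b) = push m (T̂^{g}(a,b))`, the pushforward along the substitution of letters
`b ↦ Σ_c m(b,c) c` (`NCSeries.push`). This is the coefficientwise content of the functoriality
of transport under a map pulling the connection back to a letter-substituted copy of itself.
[folklore] -/
theorem ctransport_linComb (m : β → α → ℂ) {b' : ℝ} (hb' : b' ∈ s) :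
    ctransport (fun c t => ∑ b, m b c * g b t) a b' = NCSeries.push m (ctransport g a b') := by
  funext x
  rw [ctransport_apply, NCSeries.push_eq_sum_get]
  simp only [ctransport_apply]
  rw [← citerInt_linComb_ofFn hs hso hg ha m _ _ hb', List.ofFn_get]

end LinComb

/-! ## 6. Increasing unions of domains with primitives; half-planes -/

/-- **Primitives glue along increasing unions**: if `V₀ ⊆ V₁ ⊆ ⋯` are preconnected open sets
with primitives then so is `⋃ Vₙ` (normalise the primitives at a point of `V₀`; on `V_m` the
primitives chosen on `V_n ⊇ V_m` then agree, so they patch). [folklore] -/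
theorem hasPrims_iUnion_of_monotone {V : ℕ → Set ℂ} (hmono : Monotone V) (hopen : ∀ n, IsOpen (V n))
    (hconn : ∀ n, IsPreconnected (V n)) {z₀ : ℂ} (hz₀ : z₀ ∈ V 0) (hV : ∀ n, HasPrims (V n)) :
    HasPrims (⋃ n, V n) := by
  classical
  intro g hg
  have hgn : ∀ n, DifferentiableOn ℂ g (V n) := fun n => hg.mono (subset_iUnion V n)
  choose G hG using fun n => hV n g (hgn n)
  set G' : ℕ → ℂ → ℂ := fun n z => G n z - G n z₀ with hG'_def
  have hG' : ∀ n, ∀ z ∈ V n, HasDerivAt (G' n) (g z) z := fun n z hz => (hG n z hz).sub_const _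
  have hz₀n : ∀ n, z₀ ∈ V n := fun n => hmono (Nat.zero_le n) hz₀
  have hcompat : ∀ m n, m ≤ n → ∀ z ∈ V m, G' n z = G' m z := by
    intro m n hmn z hz
    have hd : ∀ x ∈ V m, HasDerivAt (fun x => G' n x - G' m x) 0 x := by
      intro x hx
      have h := (hG' n x (hmono hmn hx)).sub (hG' m x hx)
      rwa [sub_self] at h
    have hc := (hopen m).is_const_of_deriv_eq_zero (hconn m)
      (fun x hx => (hd x hx).differentiableAt.differentiableWithinAt)
      (fun x hx => by rw [(hd x hx).deriv]; rfl) hz (hz₀n m)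
    have h00 : G' n z₀ - G' m z₀ = 0 := by simp [hG'_def]
    rwa [h00, sub_eq_zero] at hc
  let idx : ℂ → ℕ := fun z => if h : ∃ n, z ∈ V n then Nat.find h else 0
  refine ⟨fun z => G' (idx z) z, fun z hz => ?_⟩
  obtain ⟨n, hn⟩ := mem_iUnion.mp hz
  have heq : ∀ z' ∈ V n, G' (idx z') z' = G' n z' := by
    intro z' hz'
    have hex : ∃ k, z' ∈ V k := ⟨n, hz'⟩
    have hidx : idx z' = Nat.find hex := dif_pos hex
    rw [hidx]
    exact (hcompat _ _ (Nat.find_min' hex hz') z' (Nat.find_spec hex)).symm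
  exact (hG' n z hn).congr_of_eventuallyEq (eventually_of_mem ((hopen n).mem_nhds hn) heq)

/-- The **open half-plane** `{z | Re(ū (z - p)) > 0}` bounded by the line through `p` orthogonal
to `u`, on the side of `u`. [folklore] -/
def halfPlane (p u : ℂ) : Set ℂ := {z | 0 < (starRingEnd ℂ u * (z - p)).re}

/-- Membership in a half-plane. [folklore] -/
theorem mem_halfPlane {p u z : ℂ} : z ∈ halfPlane p u ↔ 0 < (starRingEnd ℂ u * (z - p)).re := Iff.rfl

/-- The defining functional in coordinates: `Re(ū w) = u₁ w₁ + u₂ w₂`. [folklore] -/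
theorem conj_mul_re (u w : ℂ) : (starRingEnd ℂ u * w).re = u.re * w.re + u.im * w.im := by
  simp [Complex.mul_re]

/-- Half-planes are open. [folklore] -/
theorem isOpen_halfPlane (p u : ℂ) : IsOpen (halfPlane p u) :=
  isOpen_lt continuous_const (Complex.continuous_re.comp (continuous_const.mul
    (continuous_id.sub continuous_const)))

/-- Half-planes are convex. [folklore] -/
theorem convex_halfPlane (p u : ℂ) : Convex ℝ (halfPlane p u) := by
  intro x hx y hy a b ha hb hab
  simp only [halfPlane, mem_setOf_eq, conj_mul_re] at hx hy ⊢
  have hre : (a • x + b • y - p).re = a * (x - p).re + b * (y - p).re := by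
    simp only [Complex.sub_re, Complex.add_re, Complex.real_smul, Complex.mul_re,
      Complex.ofReal_re, Complex.ofReal_im, zero_mul, sub_zero]
    have : p.re = a * p.re + b * p.re := by rw [← add_mul, hab, one_mul]
    linarith
  have him : (a • x + b • y - p).im = a * (x - p).im + b * (y - p).im := by
    simp only [Complex.sub_im, Complex.add_im, Complex.real_smul, Complex.mul_im,
      Complex.ofReal_re, Complex.ofReal_im, zero_mul, add_zero]
    have : p.im = a * p.im + b * p.im := by rw [← add_mul, hab, one_mul]
    linarith
  rw [hre, him]
  have hx' := hx
  have hy' := hy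
  rcases ha.eq_or_lt with rfl | ha'
  · rw [zero_add] at hab
    subst hab
    nlinarith
  · nlinarith

/-- Balls adapted to a half-plane: `z ∈ B(p + r u, r‖u‖) ↔ |z-p|² < 2 r Re(ū (z-p))`.
[folklore] -/
theorem mem_ball_halfPlane_iff {p u z : ℂ} {r : ℝ} (hr : 0 < r) :
    z ∈ ball (p + (r : ℂ) * u) (r * ‖u‖) ↔
      Complex.normSq (z - p) < 2 * r * (starRingEnd ℂ u * (z - p)).re := by
  rw [mem_ball, Complex.dist_eq]
  have hR : 0 ≤ r * ‖u‖ := mul_nonneg hr.le (norm_nonneg u)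
  rw [← sq_lt_sq₀ (norm_nonneg _) hR, ← Complex.normSq_eq_norm_sq,
    show z - (p + (r : ℂ) * u) = (z - p) - (r : ℂ) * u by ring, Complex.normSq_sub,
    Complex.normSq_mul, Complex.normSq_ofReal, mul_pow, ← Complex.normSq_eq_norm_sq,
    map_mul, Complex.conj_ofReal, show (z - p) * ((r : ℂ) * starRingEnd ℂ u) =
      (r : ℂ) * (starRingEnd ℂ u * (z - p)) by ring, Complex.re_ofReal_mul]
  constructor
  · intro h; nlinarith
  · intro h; nlinarith

/-- **A half-plane is an increasing union of discs** `B(p + (n+1)u, (n+1)‖u‖)`. [folklore] -/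
theorem halfPlane_eq_iUnion (p u : ℂ) :
    halfPlane p u = ⋃ n : ℕ, ball (p + ((n : ℝ) + 1 : ℝ) * u) (((n : ℝ) + 1) * ‖u‖) := by
  ext z
  rw [mem_halfPlane, mem_iUnion]
  constructor
  · intro hz
    obtain ⟨n, hn⟩ := exists_nat_gt (Complex.normSq (z - p) / (2 * (starRingEnd ℂ u * (z - p)).re))
    refine ⟨n, (mem_ball_halfPlane_iff (by positivity)).mpr ?_⟩
    have h2 : 0 < 2 * (starRingEnd ℂ u * (z - p)).re := by positivity
    rw [div_lt_iff₀ h2] at hn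
    nlinarith
  · rintro ⟨n, hn⟩
    rw [mem_ball_halfPlane_iff (by positivity)] at hn
    exact pos_of_mul_pos_right ((Complex.normSq_nonneg _).trans_lt hn) (by positivity)

/-- **Open half-planes have primitives.** [folklore] -/
theorem hasPrims_halfPlane (p : ℂ) {u : ℂ} (hu : u ≠ 0) : HasPrims (halfPlane p u) := by
  rw [halfPlane_eq_iUnion p u]
  have hupos : 0 < ‖u‖ := norm_pos_iff.mpr hu
  refine hasPrims_iUnion_of_monotone (fun m n hmn => ?_) (fun n => isOpen_ball)
    (fun n => (convex_ball _ _).isPreconnected) (z₀ := p + u) ?_ fun n => hasPrims_ball _ _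
  · intro z hz
    rw [mem_ball] at hz ⊢
    have hmn' : (m : ℝ) ≤ n := by exact_mod_cast hmn
    calc dist z (p + (((n : ℝ) + 1 : ℝ) : ℂ) * u)
        ≤ dist z (p + (((m : ℝ) + 1 : ℝ) : ℂ) * u) +
            dist (p + (((m : ℝ) + 1 : ℝ) : ℂ) * u) (p + (((n : ℝ) + 1 : ℝ) : ℂ) * u) :=
          dist_triangle _ _ _
      _ < ((m : ℝ) + 1) * ‖u‖ + ((n : ℝ) - m) * ‖u‖ := by
          refine add_lt_add_of_lt_of_le hz ?_
          rw [Complex.dist_eq, show p + (((m : ℝ) + 1 : ℝ) : ℂ) * u - (p + (((n : ℝ) + 1 : ℝ) : ℂ) * u)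
            = (((m : ℝ) - n : ℝ) : ℂ) * u by push_cast; ring, norm_mul, Complex.norm_real,
            Real.norm_eq_abs, abs_sub_comm, abs_of_nonneg (by linarith)]
      _ = ((n : ℝ) + 1) * ‖u‖ := by ring
  · rw [mem_ball, Complex.dist_eq, show p + u - (p + (((0 : ℕ) : ℝ) + 1 : ℝ) * u) = 0 by
      push_cast; ring, norm_zero]
    simpa using hupos

/-! ## 7. The letter substitution `σ̂ = push m` is a ring homomorphism commuting with `exp` -/

namespace NCSeries

section PushLinear

variable {β : Type*} [Fintype β] {K : Type*} [CommRing K]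

/-- Two series agreeing in every weight truncation are equal. [folklore] -/
theorem eq_of_forall_mk_eq {φ ψ : NCSeries α K}
    (h : ∀ N, Ideal.Quotient.mk (truncIdeal α K N) φ = Ideal.Quotient.mk (truncIdeal α K N) ψ) :
    φ = ψ := by
  funext w
  exact (mk_eq_mk_iff.mp (h w.length)) w le_rfl

/-- `push m` is additive (series form of `push_add`). [folklore] -/
theorem push_add_ser (m : β → α → K) (φ ψ : NCSeries β K) : push m (φ + ψ) = push m φ + push m ψ := by
  funext x; exact push_add m x φ ψ

/-- `push m` is homogeneous (series form of `push_smul`). [folklore] -/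
theorem push_smul_ser (m : β → α → K) (c : K) (φ : NCSeries β K) : push m (c • φ) = c • push m φ := by
  funext x; exact push_smul m c x φ

/-- `push m` of a negation. [folklore] -/
theorem push_neg_ser (m : β → α → K) (φ : NCSeries β K) : push m (-φ) = -push m φ := by
  rw [show -φ = (-1 : K) • φ by simp, push_smul_ser]; simp

/-- `push m` of a difference. [folklore] -/
theorem push_sub_ser (m : β → α → K) (φ ψ : NCSeries β K) : push m (φ - ψ) = push m φ - push m ψ := by
  rw [sub_eq_add_neg, push_add_ser, push_neg_ser, ← sub_eq_add_neg]

end PushLinear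

section PushAlgebra

variable {β : Type*} [Fintype β] [DecidableEq β] [Fintype α] [DecidableEq α] {K : Type*} [CommRing K]

omit [Fintype α] in
/-- Letters are nilpotent in `K⟨⟨α⟩⟩/(deg > N)`: a product of more than `N` of them vanishes.
[folklore] -/
theorem prod_map_mk_letter_eq_zero (N : ℕ) (w : List α) (hw : N < w.length) :
    (w.map fun a => Ideal.Quotient.mk (truncIdeal α K N) (letter a)).prod = 0 := by
  rw [show (fun a => Ideal.Quotient.mk (truncIdeal α K N) (letter a)) =
      Ideal.Quotient.mk (truncIdeal α K N) ∘ fun a => (letter a : NCSeries α K) from rfl,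
    ← List.map_map, ← map_list_prod]
  refine mk_list_prod_eq_zero _ (fun T hT => ?_) (by simpa using hw)
  obtain ⟨a, _, rfl⟩ := List.mem_map.mp hT
  simp

/-- `[φ] = φ([X_a])` in the truncated free algebra `K⟨⟨α⟩⟩/(deg > N)`. [folklore] -/
theorem mk_eq_evalTrunc_letter (N : ℕ) (φ : NCSeries α K) :
    Ideal.Quotient.mk (truncIdeal α K N) φ =
      evalTrunc N (fun a => Ideal.Quotient.mk (truncIdeal α K N) (letter a)) φ := by
  have h := algHom_evalTrunc (Ideal.Quotient.mkₐ K (truncIdeal α K N)) N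
    (fun a => (letter a : NCSeries α K)) φ
  rw [Ideal.Quotient.mkₐ_eq_mk] at h
  rw [show (fun a => Ideal.Quotient.mk (truncIdeal α K N) (letter a)) =
      Ideal.Quotient.mk (truncIdeal α K N) ∘ fun a => (letter a : NCSeries α K) from rfl, ← h,
    mk_eq_mk_iff]
  intro w hw
  rw [show (fun a => (letter a : NCSeries α K)) = fun a => letter ((Equiv.refl α) a) from rfl,
    evalTrunc_letter_perm_apply, if_pos hw]
  simp

omit [Fintype β] [DecidableEq β] in
/-- The substituted letters `[Σ_c m(b,c) X_c]` are nilpotent in `K⟨⟨α⟩⟩/(deg > N)`: every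
product of more than `N` of them vanishes. [folklore] -/
theorem prod_map_pushLetters_eq_zero (m : β → α → K) (N : ℕ) (w : List β) (hw : N < w.length) :
    (w.map fun b => ∑ c, m b c • Ideal.Quotient.mk (truncIdeal α K N) (letter c)).prod = 0 := by
  have h : (fun b => ∑ c, m b c • Ideal.Quotient.mk (truncIdeal α K N) (letter c)) =
      Ideal.Quotient.mk (truncIdeal α K N) ∘ fun b => ∑ c, m b c • (letter c : NCSeries α K) := by
    funext b
    rw [Function.comp_apply, map_sum]
    refine Finset.sum_congr rfl fun c _ => ?_
    rw [← Ideal.Quotient.mkₐ_eq_mk K, map_smul]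
  rw [h, ← List.map_map, ← map_list_prod]
  refine mk_list_prod_eq_zero _ (fun S hS => ?_) (by simpa using hw)
  obtain ⟨b, _, rfl⟩ := List.mem_map.mp hS
  rw [finset_sum_apply]
  exact Finset.sum_eq_zero fun c _ => by simp

omit [DecidableEq β] in
/-- **`[push m φ] = φ([Σ_c m(b,c) X_c])`**: in every truncation the pushforward is the
substitution of the substituted letters (`NCSeries.evalTrunc_push_subst`). [folklore] -/
theorem mk_push (m : β → α → K) (φ : NCSeries β K) (N : ℕ) :
    Ideal.Quotient.mk (truncIdeal α K N) (push m φ) =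
      evalTrunc N (fun b => ∑ c, m b c • Ideal.Quotient.mk (truncIdeal α K N) (letter c)) φ := by
  rw [mk_eq_evalTrunc_letter N (push m φ), evalTrunc_push_subst]

/-- **`push m` is multiplicative** (a letter substitution is an algebra endomorphism of the
completed free algebra). [cite: Reutenauer1993, §1.4] -/
theorem push_mul (m : β → α → K) (φ ψ : NCSeries β K) : push m (φ * ψ) = push m φ * push m ψ := by
  apply eq_of_forall_mk_eq
  intro N
  rw [map_mul, mk_push, mk_push, mk_push]
  exact evalTrunc_mul N _ (prod_map_pushLetters_eq_zero m N) φ ψ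

omit [DecidableEq β] in
/-- `push m 1 = 1`. [folklore] -/
theorem push_one (m : β → α → K) : push m (1 : NCSeries β K) = 1 := by
  apply eq_of_forall_mk_eq
  intro N
  rw [mk_push, evalTrunc_one, map_one]

/-- `push m` on a finite product. [folklore] -/
theorem push_list_prod (m : β → α → K) : ∀ L : List (NCSeries β K),
    push m L.prod = (L.map (push m)).prod
  | [] => by simp [push_one]
  | S :: L => by rw [List.prod_cons, push_mul, push_list_prod m L, List.map_cons, List.prod_cons]

/-- **`push m` of a letter is the substituted letter** `Σ_c m(b,c) X_c`. [folklore] -/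
theorem push_letter (m : β → α → K) (b : β) :
    push m (letter b : NCSeries β K) = ∑ c, m b c • letter c := by
  apply eq_of_forall_mk_eq
  intro N
  rw [mk_push, evalTrunc_letter N _ (prod_map_pushLetters_eq_zero m N) b, map_sum]
  refine Finset.sum_congr rfl fun c _ => ?_
  rw [← Ideal.Quotient.mkₐ_eq_mk K, map_smul]

/-- **`push m` commutes with the exponential** of a series without constant term. [folklore] -/
theorem push_exp [Algebra ℚ K] (m : β → α → K) {S : NCSeries β K} (hS : S [] = 0) :
    push m (exp S) = exp (push m S) := by
  apply eq_of_forall_mk_eq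
  intro N
  have hS' : push m S [] = 0 := by rw [push_nil, hS]
  rw [mk_push, evalTrunc_exp N _ (prod_map_pushLetters_eq_zero m N) hS,
    mk_eq_evalTrunc_letter N (exp (push m S)),
    evalTrunc_exp N _ (prod_map_mk_letter_eq_zero N) hS', ← mk_eq_evalTrunc_letter N (push m S),
    ← mk_push]

end PushAlgebra

/-! ## 8. Coefficientwise limits of families of series -/

section Limits

variable {ι : Type*} {l : Filter ι}

/-- **Products pass to coefficientwise limits** (each coefficient of a product is a finite sum
of products of coefficients). [folklore] -/
theorem tendsto_mul_apply {Φ Ψ : ι → NCSeries α ℂ} {Φ₀ Ψ₀ : NCSeries α ℂ}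
    (hΦ : ∀ u, Tendsto (fun i => Φ i u) l (𝓝 (Φ₀ u))) (hΨ : ∀ u, Tendsto (fun i => Ψ i u) l (𝓝 (Ψ₀ u)))
    (w : List α) : Tendsto (fun i => (Φ i * Ψ i) w) l (𝓝 ((Φ₀ * Ψ₀) w)) := by
  simp only [mul_apply]
  exact tendsto_finsetSum _ fun p _ => (hΦ p.1).mul (hΨ p.2)

/-- Finite products pass to coefficientwise limits. [folklore] -/
theorem tendsto_list_prod_apply {κ : Type*} (L : List κ) {Φ : κ → ι → NCSeries α ℂ}
    {Φ₀ : κ → NCSeries α ℂ} (h : ∀ k ∈ L, ∀ u, Tendsto (fun i => Φ k i u) l (𝓝 (Φ₀ k u))) :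
    ∀ w, Tendsto (fun i => (L.map fun k => Φ k i).prod w) l (𝓝 ((L.map Φ₀).prod w)) := by
  induction L with
  | nil => intro w; simpa using tendsto_const_nhds
  | cons k L ih =>
    intro w
    simp only [List.map_cons, List.prod_cons]
    exact tendsto_mul_apply (h k (by simp)) (ih fun k' hk' => h k' (by simp [hk'])) w

variable {β : Type*} [Fintype β]

/-- **Letter substitutions pass to coefficientwise limits** (each coefficient of `push m φ` is a
finite linear combination of coefficients of `φ`, `NCSeries.push_eq_sum_get`). [folklore] -/
theorem tendsto_push_apply (m : β → α → ℂ) {Φ : ι → NCSeries β ℂ} {Φ₀ : NCSeries β ℂ}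
    (hΦ : ∀ u, Tendsto (fun i => Φ i u) l (𝓝 (Φ₀ u))) (x : List α) :
    Tendsto (fun i => push m (Φ i) x) l (𝓝 (push m Φ₀ x)) := by
  simp only [push_eq_sum_get]
  exact tendsto_finsetSum _ fun u _ => (hΦ _).mul_const _

/-- A family constantly equal to `1` with a coefficientwise limit has limit `1`. [folklore] -/
theorem eq_one_of_tendsto [l.NeBot] {Φ : ι → NCSeries α ℂ} {Φ₀ : NCSeries α ℂ}
    (hΦ : ∀ u, Tendsto (fun i => Φ i u) l (𝓝 (Φ₀ u))) (h1 : ∀ i, Φ i = 1) : Φ₀ = 1 := by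
  funext u
  have h : Tendsto (fun i => Φ i u) l (𝓝 ((1 : NCSeries α ℂ) u)) := by
    simp only [h1]; exact tendsto_const_nhds
  exact tendsto_nhds_unique (hΦ u) h

end Limits

end NCSeries

/-! ### Compatibility names

`DrinfeldAssociatorHexagonProofs.lean`, as first landed, refers (inside `namespace KZHex`) to
`NCSeries.monomial_singleton_eq_smul` and `NCSeries.evalTrunc_push` of
`AssociatorsDefectSeriesProofs.lean`, which this module no longer imports (see
`NCSeries.push_eq_sum_get` for the reason). The two statements are provided here under
`KZHex.NCSeries.*`, where those references resolve; new code should use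
`NCSeries.evalTrunc_push_subst`. -/

namespace KZHex.NCSeries

/-- A one-letter monomial is a multiple of the letter. [folklore] -/
theorem monomial_singleton_eq_smul {k : Type*} [CommRing k] (a : Bool) (c : k) :
    (NCSeries.monomial [a] c : NCSeries Bool k) = c • NCSeries.letter a := by
  funext w
  rw [NCSeries.monomial_apply, NCSeries.smul_apply, NCSeries.letter_apply, smul_eq_mul, mul_ite,
    mul_one, mul_zero]

/-- **Pushforward and substitution**: `(push m φ)(v) = φ(b ↦ Σ_f m(b,f) v(f))` weight by weight
(= `NCSeries.evalTrunc_push_subst`). [cite: Reutenauer1993, §1.4] -/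
theorem evalTrunc_push {β : Type*} [Fintype β] {K : Type*} [CommRing K] {A : Type*} [Ring A]
    [Algebra K A] [Fintype α] (N : ℕ) (m : β → α → K) (v : α → A) (φ : NCSeries β K) :
    NCSeries.evalTrunc N v (NCSeries.push m φ) =
      NCSeries.evalTrunc N (fun b => ∑ f : α, m b f • v f) φ :=
  NCSeries.evalTrunc_push_subst N m v φ

end KZHex.NCSeries

end Literature.NumberTheory.Transcendental
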